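import Summits.CriticalPhenomena.PercolationContinuityZ3.Theorems.Transplant.KNParaChainSchedN
import Summits.CriticalPhenomena.PercolationContinuityZ3.Theorems.Transplant.KNCells2ChainAppend
import HarnessLib

/-!
# N1 (the `{±1}` node), LEVEL 1, (C) column file (C-N0): APPENDING two slab-target schedules `ChainPlanar.ScheduleN` (p1-g11, p269215) —
# `S₁.appendN S₂` runs `S₁` (steps `0 … N₁`) then `S₂` (its step `j` is step `N₁ + 1 + j`) when the radii agree and the first core of `S₂` IS
# the last core of `S₁`; the per-step stride data (`ax sLo sHi d Pp Pm La Lb`) and the regions are the piecewise sequences `ChainPlanar.pw`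
# (KNCells2ChainAppend, p5-g6), the prism is the union — the glue for the (C) corridor's run-frame segment (signed u-rounds ⧺ the band,
# HOME/prim-bschramm-p5-g8/C-FUNNEL.md; the ρ-frame segment is joined by the two-window chain, not by `appendN`).  N1 twin of D″'s
# `Schedule.append`; accessors are BUNDLED (`appendN_left/right`) so that no statement coincides textually with the `Schedule` ones.

builds on p205010 (kernel theorem, internal audit signed; external expert review pending) — nothing in this file uses p205010; nothing here is a
claim about the open node `SamePDropOfSkeletonNeg`.
Lane `prim-bschramm`, seat `prim-bschramm-p5` (gen 8; (C) lineage); helper file (`--supports stmt-CriticalPhenomena-4575`).  Pure `Site 2` bookkeeping.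
* **`ScheduleN.appendN S₁ S₂ (hR : S₂.R' = S₁.R') (hjoin : S₂.core 0 = S₁.core (S₁.N + 1))`**; `appendN_params` (`N = N₁ + 1 + N₂`, `R' = R'₁`,
  prism `S₁.prism ∪ S₂.prism`); **`appendN_left`** (step `k ≤ N₁`: axis, region, levels, core and the seven stride fields are those of `S₁`),
  **`appendN_right`** (step `N₁ + 1 + j`: those of `S₂` at `j`), `appendN_core_left'` (`k ≤ N₁ + 1`), `appendN_core_zero`, `appendN_core_last`.
[cite: KozmaNitzan2024, §4 Lemma 12 (pp. 23–25: the rounds are run one after the other)] [cite: MartineauTassion2017, §4.3 Lemma 4.2]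
-/

noncomputable section

namespace Summit.CriticalPhenomena.PercolationContinuityZ3.Theorems

namespace Transplant

namespace ChainPlanar

open Literature.Probability.Percolation Literature.Probability.LatticeModels
open Literature.Probability.Percolation.KozmaNitzan
open Literature.Probability.Percolation.KozmaNitzan.Cells (oth oth_ne eq_oth_of_ne)

namespace ScheduleN

/-- **Appending two slab-target schedules**: run `S₁` (steps `0, …, N₁`), then `S₂` (its step `j` becomes step `N₁ + 1 + j`), provided the radii
agree and the first core of `S₂` is the last core of `S₁`; stride data and regions piecewise, prism the union.
[cite: KozmaNitzan2024, §4 Lemma 12 (pp. 23–25)] -/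
def appendN (S₁ S₂ : ScheduleN) (hR : S₂.R' = S₁.R') (hjoin : S₂.core 0 = S₁.core (S₁.N + 1)) : ScheduleN where
  ax := pw S₁.N S₁.ax S₂.ax
  lo := pw S₁.N S₁.lo S₂.lo
  hi := pw S₁.N S₁.hi S₂.hi
  region := pw S₁.N S₁.region S₂.region
  prism := S₁.prism ∪ S₂.prism
  N := S₁.N + 1 + S₂.N
  R' := S₁.R'
  sLo := pw S₁.N S₁.sLo S₂.sLo
  sHi := pw S₁.N S₁.sHi S₂.sHi
  d := pw S₁.N S₁.d S₂.d
  Pp := pw S₁.N S₁.Pp S₂.Pp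
  Pm := pw S₁.N S₁.Pm S₂.Pm
  La := pw S₁.N S₁.La S₂.La
  Lb := pw S₁.N S₁.Lb S₂.Lb
  encl k hk := by
    by_cases h : k ≤ S₁.N
    · simp only [pw_of_le _ _ h]
      exact S₁.encl k h
    · obtain ⟨j, rfl⟩ : ∃ j, k = S₁.N + 1 + j := ⟨k - (S₁.N + 1), by omega⟩
      simp only [pw_add, ← hR]
      exact S₂.encl j (by omega)
  succ k hk := by
    by_cases h : k + 1 ≤ S₁.N
    · simp only [pw_of_le _ _ h, pw_of_le _ _ (Nat.le_of_succ_le h)]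
      exact S₁.succ k (Nat.le_of_succ_le h)
    · by_cases h' : k = S₁.N
      · subst h'
        rw [pw_of_le _ _ le_rfl, pw_of_not_le _ _ (by omega), pw_of_not_le _ _ (by omega), Nat.sub_self]
        have e : Finset.Icc (S₂.lo 0) (S₂.hi 0) = S₂.core 0 := rfl
        rw [e, hjoin]
        exact S₁.succ S₁.N le_rfl
      · obtain ⟨j, rfl⟩ : ∃ j, k = S₁.N + 1 + j := ⟨k - (S₁.N + 1), by omega⟩
        simp only [pw_add, pw_add_succ]
        exact S₂.succ j (by omega)
  sub_prism k hk := by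
    by_cases h : k ≤ S₁.N
    · simp only [pw_of_le _ _ h]
      exact (S₁.sub_prism k h).trans Finset.subset_union_left
    · obtain ⟨j, rfl⟩ : ∃ j, k = S₁.N + 1 + j := ⟨k - (S₁.N + 1), by omega⟩
      simp only [pw_add]
      exact (S₂.sub_prism j (by omega)).trans Finset.subset_union_right
  nonempty k hk := by
    by_cases h : k ≤ S₁.N
    · simp only [pw_of_le _ _ h]
      exact S₁.nonempty k (by omega)
    · obtain ⟨j, rfl⟩ : ∃ j, k = S₁.N + 1 + j := ⟨k - (S₁.N + 1), by omega⟩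
      simp only [pw_add]
      exact S₂.nonempty j (by omega)
  route k hk v hv := by
    by_cases h : k ≤ S₁.N
    · simp only [pw_of_le _ _ h] at hv ⊢
      obtain ⟨σ, hσ, hlink, τ, hτ, hland⟩ := S₁.route k h v hv
      refine ⟨σ, hσ, hlink, τ, hτ, fun y e1 e2 e3 => ?_⟩
      have hy := hland y e1 e2 e3
      by_cases h' : k + 1 ≤ S₁.N
      · simp only [pw_of_le _ _ h']
        exact hy
      · have ek : k = S₁.N := by omega
        subst ek
        rw [pw_of_not_le _ _ (by omega), pw_of_not_le _ _ (by omega), Nat.sub_self]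
        have e : Finset.Icc (S₂.lo 0) (S₂.hi 0) = S₂.core 0 := rfl
        rw [e, hjoin]
        exact hy
    · obtain ⟨j, rfl⟩ : ∃ j, k = S₁.N + 1 + j := ⟨k - (S₁.N + 1), by omega⟩
      simp only [pw_add, pw_add_succ, ← hR] at hv ⊢
      exact S₂.route j (by omega) v hv

variable (S₁ S₂ : ScheduleN) (hR : S₂.R' = S₁.R') (hjoin : S₂.core 0 = S₁.core (S₁.N + 1))

/-- The parameters of the appended slab-target schedule: `N = N₁ + 1 + N₂`, `R' = R'₁`, prism the union. [folklore] -/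
theorem appendN_params : (S₁.appendN S₂ hR hjoin).N = S₁.N + 1 + S₂.N ∧ (S₁.appendN S₂ hR hjoin).R' = S₁.R' ∧
    (S₁.appendN S₂ hR hjoin).prism = S₁.prism ∪ S₂.prism :=
  ⟨rfl, rfl, rfl⟩

/-- **The first steps (`k ≤ N₁`) of the appended schedule are the steps of `S₁`**: axis, region, levels, core and the seven stride fields. [folklore] -/
theorem appendN_left {k : ℕ} (hk : k ≤ S₁.N) :
    (S₁.appendN S₂ hR hjoin).ax k = S₁.ax k ∧ (S₁.appendN S₂ hR hjoin).region k = S₁.region k ∧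
    (∀ i, (S₁.appendN S₂ hR hjoin).level k i = S₁.level k i) ∧ (S₁.appendN S₂ hR hjoin).core k = S₁.core k ∧
    (S₁.appendN S₂ hR hjoin).sLo k = S₁.sLo k ∧ (S₁.appendN S₂ hR hjoin).sHi k = S₁.sHi k ∧ (S₁.appendN S₂ hR hjoin).d k = S₁.d k ∧
    (S₁.appendN S₂ hR hjoin).Pp k = S₁.Pp k ∧ (S₁.appendN S₂ hR hjoin).Pm k = S₁.Pm k ∧ (S₁.appendN S₂ hR hjoin).La k = S₁.La k ∧
    (S₁.appendN S₂ hR hjoin).Lb k = S₁.Lb k := by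
  refine ⟨pw_of_le _ _ hk, pw_of_le _ _ hk, fun i => ?_, ?_, pw_of_le _ _ hk, pw_of_le _ _ hk, pw_of_le _ _ hk, pw_of_le _ _ hk,
    pw_of_le _ _ hk, pw_of_le _ _ hk, pw_of_le _ _ hk⟩
  · show Finset.Icc (pw S₁.N S₁.lo S₂.lo k - ((i : ℕ) : Site 2)) (pw S₁.N S₁.hi S₂.hi k + ((i : ℕ) : Site 2)) = _
    rw [pw_of_le _ _ hk, pw_of_le _ _ hk]; rfl
  · show Finset.Icc (pw S₁.N S₁.lo S₂.lo k) (pw S₁.N S₁.hi S₂.hi k) = _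
    rw [pw_of_le _ _ hk, pw_of_le _ _ hk]; rfl

/-- **The later steps (`N₁ + 1 + j`) of the appended schedule are the steps of `S₂` at `j`**: axis, region, levels, core and the seven stride fields.
[folklore] -/
theorem appendN_right (j : ℕ) :
    (S₁.appendN S₂ hR hjoin).ax (S₁.N + 1 + j) = S₂.ax j ∧ (S₁.appendN S₂ hR hjoin).region (S₁.N + 1 + j) = S₂.region j ∧
    (∀ i, (S₁.appendN S₂ hR hjoin).level (S₁.N + 1 + j) i = S₂.level j i) ∧ (S₁.appendN S₂ hR hjoin).core (S₁.N + 1 + j) = S₂.core j ∧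
    (S₁.appendN S₂ hR hjoin).sLo (S₁.N + 1 + j) = S₂.sLo j ∧ (S₁.appendN S₂ hR hjoin).sHi (S₁.N + 1 + j) = S₂.sHi j ∧
    (S₁.appendN S₂ hR hjoin).d (S₁.N + 1 + j) = S₂.d j ∧ (S₁.appendN S₂ hR hjoin).Pp (S₁.N + 1 + j) = S₂.Pp j ∧
    (S₁.appendN S₂ hR hjoin).Pm (S₁.N + 1 + j) = S₂.Pm j ∧ (S₁.appendN S₂ hR hjoin).La (S₁.N + 1 + j) = S₂.La j ∧
    (S₁.appendN S₂ hR hjoin).Lb (S₁.N + 1 + j) = S₂.Lb j := by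
  refine ⟨pw_add _ _ _ _, pw_add _ _ _ _, fun i => ?_, ?_, pw_add _ _ _ _, pw_add _ _ _ _, pw_add _ _ _ _, pw_add _ _ _ _, pw_add _ _ _ _,
    pw_add _ _ _ _, pw_add _ _ _ _⟩
  · show Finset.Icc (pw S₁.N S₁.lo S₂.lo (S₁.N + 1 + j) - ((i : ℕ) : Site 2)) (pw S₁.N S₁.hi S₂.hi (S₁.N + 1 + j) + ((i : ℕ) : Site 2)) = _
    rw [pw_add, pw_add]; rfl
  · show Finset.Icc (pw S₁.N S₁.lo S₂.lo (S₁.N + 1 + j)) (pw S₁.N S₁.hi S₂.hi (S₁.N + 1 + j)) = _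
    rw [pw_add, pw_add]; rfl

/-- The cores up to the joint (`k ≤ N₁ + 1`) of the appended slab-target schedule are the cores of `S₁`. [folklore] -/
theorem appendN_core_left' {k : ℕ} (hk : k ≤ S₁.N + 1) : (S₁.appendN S₂ hR hjoin).core k = S₁.core k := by
  rcases Nat.lt_or_eq_of_le hk with h | rfl
  · exact (appendN_left S₁ S₂ hR hjoin (Nat.lt_succ_iff.1 h)).2.2.2.1
  · rw [show S₁.N + 1 = S₁.N + 1 + 0 by omega, (appendN_right S₁ S₂ hR hjoin 0).2.2.2.1, hjoin]

/-- The first core of the appended slab-target schedule is the first core of `S₁`. [folklore] -/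
theorem appendN_core_zero : (S₁.appendN S₂ hR hjoin).core 0 = S₁.core 0 := (appendN_left S₁ S₂ hR hjoin (Nat.zero_le _)).2.2.2.1

/-- **The last core of the appended slab-target schedule is the last core of `S₂`.** [folklore] -/
theorem appendN_core_last : (S₁.appendN S₂ hR hjoin).core ((S₁.appendN S₂ hR hjoin).N + 1) = S₂.core (S₂.N + 1) := by
  rw [(appendN_params S₁ S₂ hR hjoin).1, show S₁.N + 1 + S₂.N + 1 = S₁.N + 1 + (S₂.N + 1) by omega,
    (appendN_right S₁ S₂ hR hjoin (S₂.N + 1)).2.2.2.1]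

/-- Every region of the appended slab-target schedule lies in `S₁.prism ∪ S₂.prism`. [folklore] -/
theorem appendN_region_subset {k : ℕ} (hk : k ≤ (S₁.appendN S₂ hR hjoin).N) : (S₁.appendN S₂ hR hjoin).region k ⊆ S₁.prism ∪ S₂.prism :=
  (S₁.appendN S₂ hR hjoin).sub_prism k hk

end ScheduleN

end ChainPlanar

end Transplant

end Summit.CriticalPhenomena.PercolationContinuityZ3.Theorems

end
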